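import Literature.Analysis.Calculus.ExpDuhamel
import Literature.MathematicalPhysics.QuantumFieldTheory.TiltedExponentMorseBounds

/-!
# T⁴ programme, spine node NE1′ (O3b/H2), COUPLING LINE — leaf L5 (linear level), the STRUCTURE LEMMA of the skeleton
# `t4/skeletons/NE1p-t4-ne1p-p3.md` (v0.6): the pathwise difference of a loop variable between the dressed and the undressed
# tower is, to first order, a sum of PAIRINGS ⟨covector of the unperturbed (unit) field, displacement vector⟩, each LINEAR in
# the one-bond displacement vector; conjugation-invariant scalars appear only at SECOND order; the covectors have norm `≤ ‖φ‖`
# and transform contragrediently to `Ad` under lattice gauge transformations along a closed walk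

Cell `pub-balaban`, unit `b2b-balaban-t4-ne1p-p3` (ROUND-2 technique-distinct prover #3 on BINDER row NE1′, technique «coupling of
block-spin towers: run the dressed and undressed towers on one probability space and bound the difference pathwise»), generation 30;
item (m1) of the division of labour agreed with road P4 (`t4-ne1p-p4`, journal l.5166/5175/5206); companion of
`Support/NE1pDisplacementTransport` (the GROUP level in the tree's vocabulary: transport identity for `T4Continuum.holAt`, gauge
equivariance of the one-bond quotients up the averaging tower via [Balaban1985Averaging] (11), size = `bdist`).  This file is OUR
elementary lemma (new work ⇒ `Summits/`), Mathlib + the tree's `ExpDuhamel` / `TiltedExponentMorseBounds` only; everything is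
PROVED, nothing is a `def … : Prop` hypothesis, nothing of T. Bałaban's series is asserted or cited.

HONEST FRAMING (T4-DAG p. 1).  Rung (B)+1 on ONE finite four-torus of fixed physical size; NOT infinite volume, NOT a mass gap,
NOT the Clay problem, NOT summit progress.  HONEST DEPENDENCY (verbatim): continuum YM on T⁴ ⇐ BetaPertH ∧ nine spine estimates
(0/9 proved); BetaPertH ⇐ (D1) ∧ (D4) ∧ CAP+tail; G-an2-4 gates asym, D1 and NE2/3/4.

DICTIONARY (prose, not asserted): `𝔸 = M_N(ℂ)` with the operator norm (`‖1‖ = 1`); `u_i` = the unitary step variables of the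
UNPERTURBED unit-lattice holonomy of the loop (the undressed tower's `avgⁿ` of the old configuration), `u′_i = e^{η_i}u_i` the
perturbed ones (the insert), `η_i ∈ 𝔲(N)` = the one-step displacement VECTORS (`θ₁ⁿ𝒱_{e,ℓ}` of the skeleton; size from leaf L3,
NOT supplied here), `φ = Re tr/N` (`‖φ‖ ≤ 1`, conjugation invariant), `covector φ u m i` = the skeleton's `H_ℓ(y)`.

WHAT IS PROVED ([folklore], abstract normed ring `𝔸`, `‖1‖ = 1` where norms are compared).
* `firstOrder u d m = Σ_{i<m} (u₀⋯u_{i−1})·d_i·(u_{i+1}⋯u_{m−1})`, `firstOrder_succ` (Leibniz recursion), `firstOrder_sub`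
  (linearity), `norm_firstOrder_le`;
* `norm_pprod_sub_pprod_le`, `norm_rem_le`, `norm_rem_le_sq_half` — ZEROTH ORDER and SECOND-ORDER TAYLOR REMAINDER of an ordered
  product with factors of norm `≤ 1`: `‖∏u′ − ∏u‖ ≤ Σ x_i` and `‖∏u′ − ∏u − firstOrder u (u′ − u) m‖ ≤ Σ_{j<m}(Σ_{i<j} x_i)·x_j ≤
  (Σ x_i)²/2` for `‖u′_i − u_i‖ ≤ x_i` — no single perturbation survives beyond the first-order term;
* `norm_rem_exp_le`, `norm_rem_exp_le_three_mul_sq` (with the tree's `ExpDuhamel.norm_exp_sub_one_le` and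
  `OneLinkLaplace.norm_exp_sub_one_sub_le`, imported BY NAME) — the EXPONENTIAL FORM, first-order term LINEAR IN THE VECTORS `η_i`:
  `‖∏(e^{η_i}u_i) − ∏u_i − firstOrder u (η·u) m‖ ≤ (Σ(e^{‖η_i‖} − 1))²/2 + Σ(e^{‖η_i‖} − 1 − ‖η_i‖) ≤ 3σ²`, `σ = Σ‖η_i‖ `, all
  `‖η_i‖ ≤ 1`;
* `covector`, `norm_covector_le`, `sum_covector_apply_eq`, `norm_sub_sub_sum_covector_le` — THE STRUCTURE STATEMENT read through a
  continuous linear `φ`: `φ(∏e^{η_i}u_i) − φ(∏u_i) = Σ_i ⟨covector φ u m i, η_i⟩ + ρ`, the covectors built from the unperturbed `u`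
  ONLY with operator norm `≤ ‖φ‖`, `‖ρ‖ ≤ ‖φ‖·(second-order bound)` — every conjugation-INVARIANT scalar of the `η_i` (traces of
  products, norms) is at least quadratic and sits in `ρ`; this settles the skeleton's falsifier F1 («if the θ₁ⁿ-order part contained
  an Ad-invariant scalar, L6 (Schur) could not apply and the line would die at L5») BY PROOF;
* `pprod_conjAct`, `sprod_conjAct`, `covector_conjAct_apply` — CONTRAGREDIENCE: under `u_i ↦ h_i u_i h_{i+1}⁻¹` (a lattice gauge
  transformation along the walk), `X ↦ h_i X h_i⁻¹` (`Ad`) at position `i`, a conjugation-invariant `φ` and a CLOSED walk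
  (`h_m = h_0`), every pairing `covector φ u m i (X)` is unchanged — the bookkeeping that lets Schur's lemma act on the conditional
  mean of an `Ad`-equivariant vector in leaf L6 (S) (tree `T4ExteriorCovariance.integral_eq_zero_of_equivariant`,
  `T4AdInvariant.integral_eq_zero_of_noFixedVector`; this lineage's `Support/NE1pEquivariantSchwarz`).
NOT PROVED, NOT CLAIMED: any bound on the `‖η_i‖` for Bałaban's averages (leaf L3, printed rate, typed in the tree, not discharged);
anything about conditional means, densities or large fields (leaves L4, L6); the instantiation `G ⊂ U(N) ⊂ M_N(ℂ)` (the tree does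
not fix the matrix model, `Setup` DIVERGENCE F4).
-/

noncomputable section

open NormedSpace Finset

namespace Summit.QuantumFields.BalabanUV.T4Continuum.NE1pCouplingStructure

/-! ## §2 Linear level: the first-order expansion of an ordered product, its covector form, the second-order remainder -/

section Algebra

variable {𝔸 : Type*} [NormedRing 𝔸]

/-- The ordered prefix product `u 0 · u 1 ⋯ u (m−1)` in the algebra. [folklore] -/
def pprod (u : ℕ → 𝔸) (m : ℕ) : 𝔸 := ((List.range m).map u).prod

/-- Empty product. [folklore] -/
@[simp] theorem pprod_zero (u : ℕ → 𝔸) : pprod u 0 = 1 := by simp [pprod]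

/-- One more factor on the right. [folklore] -/
theorem pprod_succ (u : ℕ → 𝔸) (m : ℕ) : pprod u (m + 1) = pprod u m * u m := List.prod_range_succ u m

/-- The ordered product of the window `u a · u (a+1) ⋯ u (a+n−1)`. [folklore] -/
def sprod (u : ℕ → 𝔸) (a n : ℕ) : 𝔸 := pprod (fun i => u (a + i)) n

/-- Empty window. [folklore] -/
@[simp] theorem sprod_zero (u : ℕ → 𝔸) (a : ℕ) : sprod u a 0 = 1 := pprod_zero _

/-- One more factor on the right of the window. [folklore] -/
theorem sprod_succ (u : ℕ → 𝔸) (a n : ℕ) : sprod u a (n + 1) = sprod u a n * u (a + n) := pprod_succ _ _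

/-- **THE FIRST-ORDER TERM** of the expansion of `∏ (u_i + d_i)` about `∏ u_i`:
`Σ_{i<m} (u₀⋯u_{i−1}) · d_i · (u_{i+1}⋯u_{m−1})` — LINEAR in each `d_i`, coefficients from the unperturbed `u` only. [folklore] -/
def firstOrder (u d : ℕ → 𝔸) (m : ℕ) : 𝔸 := ∑ i ∈ range m, pprod u i * d i * sprod u (i + 1) (m - 1 - i)

/-- No factors: no first-order term. [folklore] -/
@[simp] theorem firstOrder_zero (u d : ℕ → 𝔸) : firstOrder u d 0 = 0 := by simp [firstOrder]

/-- The Leibniz recursion: `firstOrder (m+1) = firstOrder m · u_m + (u₀⋯u_{m−1}) · d_m`. [folklore] -/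
theorem firstOrder_succ (u d : ℕ → 𝔸) (m : ℕ) :
    firstOrder u d (m + 1) = firstOrder u d m * u m + pprod u m * d m := by
  rw [firstOrder, sum_range_succ, firstOrder, sum_mul]
  have h0 : m + 1 - 1 - m = 0 := by omega
  rw [h0, sprod_zero, mul_one]
  congr 1
  refine sum_congr rfl fun i hi => ?_
  rw [mem_range] at hi
  have h1 : m + 1 - 1 - i = (m - 1 - i) + 1 := by omega
  have h2 : i + 1 + (m - 1 - i) = m := by omega
  rw [h1, sprod_succ, h2, ← mul_assoc]

/-- The first-order term is linear in the perturbation: differences. [folklore] -/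
theorem firstOrder_sub (u d d' : ℕ → 𝔸) (m : ℕ) :
    firstOrder u d m - firstOrder u d' m = firstOrder u (fun i => d i - d' i) m := by
  simp only [firstOrder, ← sum_sub_distrib, mul_sub, sub_mul]

/-- The LATTICE GAUGE TRANSFORMATION of the step variables along a walk by units `h_i` at its sites:
`u_i ↦ h_i · u_i · h_{i+1}⁻¹`. [folklore] -/
def conjAct (h : ℕ → 𝔸ˣ) (u : ℕ → 𝔸) : ℕ → 𝔸 := fun i => (h i : 𝔸) * u i * ((h (i + 1))⁻¹ : 𝔸ˣ)

/-- Prefix products telescope: `∏_{i<n} (h_i u_i h_{i+1}⁻¹) = h_0 · (∏_{i<n} u_i) · h_n⁻¹`. [folklore] -/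
theorem pprod_conjAct (h : ℕ → 𝔸ˣ) (u : ℕ → 𝔸) (n : ℕ) :
    pprod (conjAct h u) n = (h 0 : 𝔸) * pprod u n * ((h n)⁻¹ : 𝔸ˣ) := by
  induction n with
  | zero => simp
  | succ n ih =>
    rw [pprod_succ, pprod_succ, ih, conjAct]
    simp only [mul_assoc, Units.inv_mul_cancel_left]

/-- Window products telescope: `∏_{a≤i<a+n} (h_i u_i h_{i+1}⁻¹) = h_a · (∏ u_i) · h_{a+n}⁻¹`. [folklore] -/
theorem sprod_conjAct (h : ℕ → 𝔸ˣ) (u : ℕ → 𝔸) (a n : ℕ) :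
    sprod (conjAct h u) a n = (h a : 𝔸) * sprod u a n * ((h (a + n))⁻¹ : 𝔸ˣ) := by
  have e : (fun i => conjAct h u (a + i)) = conjAct (fun i => h (a + i)) (fun i => u (a + i)) := by
    funext i
    simp only [conjAct, add_assoc]
  rw [sprod, e, pprod_conjAct]
  simp only [add_zero, sprod]

section UnitBall

variable [NormOneClass 𝔸]

/-- A product of factors of norm `≤ 1` has norm `≤ 1`. [folklore] -/
theorem norm_pprod_le_one {u : ℕ → 𝔸} {m : ℕ} (hu : ∀ i < m, ‖u i‖ ≤ 1) : ‖pprod u m‖ ≤ 1 := by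
  induction m with
  | zero => simp
  | succ m ih =>
    rw [pprod_succ]
    have h := norm_mul_le_of_le (ih fun i hi => hu i (by omega)) (hu m (by omega))
    rwa [mul_one] at h

/-- A window product of factors of norm `≤ 1` has norm `≤ 1`. [folklore] -/
theorem norm_sprod_le_one {u : ℕ → 𝔸} {a n : ℕ} (hu : ∀ i, a ≤ i → i < a + n → ‖u i‖ ≤ 1) : ‖sprod u a n‖ ≤ 1 :=
  norm_pprod_le_one fun i hi => hu (a + i) (by omega) (by omega)

/-- The first-order term is bounded by the sum of the sizes of the perturbations (factors of norm `≤ 1`). [folklore] -/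
theorem norm_firstOrder_le {u d : ℕ → 𝔸} {r : ℕ → ℝ} {m : ℕ} (hu : ∀ i < m, ‖u i‖ ≤ 1)
    (hd : ∀ i < m, ‖d i‖ ≤ r i) : ‖firstOrder u d m‖ ≤ ∑ i ∈ range m, r i := by
  refine (norm_sum_le _ _).trans (sum_le_sum fun i hi => ?_)
  rw [mem_range] at hi
  have h1 : ‖pprod u i * d i‖ ≤ 1 * r i := norm_mul_le_of_le (norm_pprod_le_one fun k hk => hu k (by omega)) (hd i hi)
  have h2 : ‖sprod u (i + 1) (m - 1 - i)‖ ≤ 1 := norm_sprod_le_one fun k _ hk => hu k (by omega)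
  have h := norm_mul_le_of_le h1 h2
  rwa [one_mul, mul_one] at h

variable {u u' : ℕ → 𝔸} {x : ℕ → ℝ} {m : ℕ}

/-- ZEROTH ORDER: `‖∏u′ − ∏u‖ ≤ Σ ‖u′_i − u_i‖` for factors of norm `≤ 1` (telescoping). [folklore] -/
theorem norm_pprod_sub_pprod_le (hu : ∀ i < m, ‖u i‖ ≤ 1) (hu' : ∀ i < m, ‖u' i‖ ≤ 1)
    (hx : ∀ i < m, ‖u' i - u i‖ ≤ x i) : ‖pprod u' m - pprod u m‖ ≤ ∑ i ∈ range m, x i := by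
  induction m with
  | zero => simp
  | succ m ih =>
    have e : pprod u' (m + 1) - pprod u (m + 1) = (pprod u' m - pprod u m) * u m + pprod u' m * (u' m - u m) := by
      rw [pprod_succ, pprod_succ]; noncomm_ring
    rw [e, sum_range_succ]
    refine (norm_add_le _ _).trans (add_le_add ?_ ?_)
    · have h := norm_mul_le_of_le (ih (fun i hi => hu i (by omega)) (fun i hi => hu' i (by omega))
        fun i hi => hx i (by omega)) (hu m (by omega))
      rwa [mul_one] at h
    · have h := norm_mul_le_of_le (norm_pprod_le_one (m := m) fun i hi => hu' i (by omega)) (hx m (by omega))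
      rwa [one_mul] at h

/-- **THE SECOND-ORDER REMAINDER** of the expansion of an ordered product with factors of norm `≤ 1`:
`‖∏u′ − ∏u − firstOrder u (u′ − u) m‖ ≤ Σ_{j<m} (Σ_{i<j} x_i)·x_j` for `‖u′_i − u_i‖ ≤ x_i` — the sum of the products of the
sizes of PAIRS of perturbed factors: no single perturbation survives beyond the first-order term. [folklore] -/
theorem norm_rem_le (hu : ∀ i < m, ‖u i‖ ≤ 1) (hu' : ∀ i < m, ‖u' i‖ ≤ 1) (hx : ∀ i < m, ‖u' i - u i‖ ≤ x i) :
    ‖pprod u' m - pprod u m - firstOrder u (fun i => u' i - u i) m‖ ≤ ∑ j ∈ range m, (∑ i ∈ range j, x i) * x j := by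
  induction m with
  | zero => simp
  | succ m ih =>
    have e : pprod u' (m + 1) - pprod u (m + 1) - firstOrder u (fun i => u' i - u i) (m + 1)
        = (pprod u' m - pprod u m - firstOrder u (fun i => u' i - u i) m) * u m
          + (pprod u' m - pprod u m) * (u' m - u m) := by
      rw [pprod_succ, pprod_succ, firstOrder_succ]; noncomm_ring
    rw [e, sum_range_succ]
    refine (norm_add_le _ _).trans (add_le_add ?_ ?_)
    · have h := norm_mul_le_of_le (ih (fun i hi => hu i (by omega)) (fun i hi => hu' i (by omega))
        fun i hi => hx i (by omega)) (hu m (by omega))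
      rwa [mul_one] at h
    · exact norm_mul_le_of_le (norm_pprod_sub_pprod_le (fun i hi => hu i (by omega)) (fun i hi => hu' i (by omega))
        fun i hi => hx i (by omega)) (hx m (by omega))

/-- The pair sum is at most half the square of the total size: `Σ_{j<m} (Σ_{i<j} x_i)·x_j ≤ (Σ_{i<m} x_i)²/2` (`x ≥ 0`). [folklore] -/
theorem sum_sum_mul_le_sq_half (hx : ∀ i < m, 0 ≤ x i) :
    ∑ j ∈ range m, (∑ i ∈ range j, x i) * x j ≤ (∑ i ∈ range m, x i) ^ 2 / 2 := by
  induction m with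
  | zero => simp
  | succ m ih =>
    rw [sum_range_succ, sum_range_succ]
    have h0 : 0 ≤ x m := hx m (by omega)
    have ih' := ih fun i hi => hx i (by omega)
    nlinarith [sq_nonneg (x m)]

/-- `Σ x_i² ≤ (Σ x_i)²` for `x ≥ 0`. [folklore] -/
theorem sum_sq_le_sq_sum (hx : ∀ i < m, 0 ≤ x i) :
    ∑ i ∈ range m, x i ^ 2 ≤ (∑ i ∈ range m, x i) ^ 2 := by
  induction m with
  | zero => simp
  | succ m ih =>
    rw [sum_range_succ, sum_range_succ]
    have h0 : 0 ≤ x m := hx m (by omega)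
    have hs : 0 ≤ ∑ i ∈ range m, x i := sum_nonneg fun i hi => hx i (by rw [mem_range] at hi; omega)
    have ih' := ih fun i hi => hx i (by omega)
    nlinarith

/-- **THE REMAINDER, QUADRATIC FORM**: `‖∏u′ − ∏u − firstOrder u (u′ − u) m‖ ≤ (Σ_{i<m} x_i)²/2`. [folklore] -/
theorem norm_rem_le_sq_half (hu : ∀ i < m, ‖u i‖ ≤ 1) (hu' : ∀ i < m, ‖u' i‖ ≤ 1)
    (hx : ∀ i < m, ‖u' i - u i‖ ≤ x i) :
    ‖pprod u' m - pprod u m - firstOrder u (fun i => u' i - u i) m‖ ≤ (∑ i ∈ range m, x i) ^ 2 / 2 :=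
  (norm_rem_le hu hu' hx).trans (sum_sum_mul_le_sq_half fun i hi => (norm_nonneg _).trans (hx i hi))

end UnitBall

end Algebra

/-! ## §2b The multiplicative (exponential) form: perturbed factors `e^{η_i} u_i`, first order LINEAR IN THE VECTORS `η_i` -/

section Exp

variable {𝔸 : Type*} [NormedRing 𝔸] [NormedAlgebra ℝ 𝔸] [CompleteSpace 𝔸]

variable [NormOneClass 𝔸] {u η : ℕ → 𝔸} {m : ℕ}

/-- **THE STRUCTURE LEMMA, EXPONENTIAL FORM**: for unperturbed factors `u_i` and perturbed factors `e^{η_i}u_i`, all of norm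
`≤ 1` (the unitary case), `‖∏(e^{η_i}u_i) − ∏u_i − firstOrder u (η·u) m‖ ≤ (Σ(e^{‖η_i‖} − 1))²/2 + Σ(e^{‖η_i‖} − 1 − ‖η_i‖)`: the
first-order part is LINEAR IN THE VECTORS `η_i` with coefficients from `u` only; everything else is second order. [folklore] -/
theorem norm_rem_exp_le (hu : ∀ i < m, ‖u i‖ ≤ 1) (hu' : ∀ i < m, ‖exp (η i) * u i‖ ≤ 1) :
    ‖pprod (fun i => exp (η i) * u i) m - pprod u m - firstOrder u (fun i => η i * u i) m‖
      ≤ (∑ i ∈ range m, (Real.exp ‖η i‖ - 1)) ^ 2 / 2 + ∑ i ∈ range m, (Real.exp ‖η i‖ - 1 - ‖η i‖) := by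
  have hx : ∀ i < m, ‖exp (η i) * u i - u i‖ ≤ Real.exp ‖η i‖ - 1 := fun i hi => by
    have e : exp (η i) * u i - u i = (exp (η i) - 1) * u i := by noncomm_ring
    rw [e]
    have h := norm_mul_le_of_le (Literature.Analysis.Calculus.norm_exp_sub_one_le (η i)) (hu i hi)
    rwa [mul_one] at h
  have hA := norm_rem_le_sq_half hu hu' hx
  have e : pprod (fun i => exp (η i) * u i) m - pprod u m - firstOrder u (fun i => η i * u i) m
      = (pprod (fun i => exp (η i) * u i) m - pprod u m - firstOrder u (fun i => exp (η i) * u i - u i) m)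
        + (firstOrder u (fun i => exp (η i) * u i - u i) m - firstOrder u (fun i => η i * u i) m) := by abel
  have hB : ‖firstOrder u (fun i => exp (η i) * u i - u i) m - firstOrder u (fun i => η i * u i) m‖
      ≤ ∑ i ∈ range m, (Real.exp ‖η i‖ - 1 - ‖η i‖) := by
    rw [firstOrder_sub]
    refine norm_firstOrder_le hu fun i hi => ?_
    have e' : exp (η i) * u i - u i - η i * u i = (exp (η i) - 1 - η i) * u i := by noncomm_ring
    rw [e']
    have h := norm_mul_le_of_le
      (Literature.MathematicalPhysics.QuantumFieldTheory.OneLinkLaplace.norm_exp_sub_one_sub_le (η i)) (hu i hi)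
    rwa [mul_one] at h
  rw [e]
  exact (norm_add_le _ _).trans (add_le_add hA hB)

/-- **SMALL VECTORS**: if moreover every `‖η_i‖ ≤ 1`, the remainder is `≤ 3σ²`, `σ = Σ_{i<m} ‖η_i‖` (Mathlib's
`Real.abs_exp_sub_one_le`, `Real.abs_exp_sub_one_sub_id_le`). [folklore] -/
theorem norm_rem_exp_le_three_mul_sq (hu : ∀ i < m, ‖u i‖ ≤ 1) (hu' : ∀ i < m, ‖exp (η i) * u i‖ ≤ 1)
    (hη : ∀ i < m, ‖η i‖ ≤ 1) :
    ‖pprod (fun i => exp (η i) * u i) m - pprod u m - firstOrder u (fun i => η i * u i) m‖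
      ≤ 3 * (∑ i ∈ range m, ‖η i‖) ^ 2 := by
  refine (norm_rem_exp_le hu hu').trans ?_
  have h1 : ∑ i ∈ range m, (Real.exp ‖η i‖ - 1) ≤ 2 * ∑ i ∈ range m, ‖η i‖ := by
    rw [mul_sum]
    refine sum_le_sum fun i hi => ?_
    rw [mem_range] at hi
    have h := Real.abs_exp_sub_one_le (x := ‖η i‖) (by rw [abs_of_nonneg (norm_nonneg _)]; exact hη i hi)
    rw [abs_of_nonneg (norm_nonneg _)] at h
    exact (le_abs_self _).trans h
  have h2 : ∑ i ∈ range m, (Real.exp ‖η i‖ - 1 - ‖η i‖) ≤ ∑ i ∈ range m, ‖η i‖ ^ 2 := by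
    refine sum_le_sum fun i hi => ?_
    rw [mem_range] at hi
    have h := Real.abs_exp_sub_one_sub_id_le (x := ‖η i‖) (by rw [abs_of_nonneg (norm_nonneg _)]; exact hη i hi)
    exact (le_abs_self _).trans h
  have h3 : ∑ i ∈ range m, ‖η i‖ ^ 2 ≤ (∑ i ∈ range m, ‖η i‖) ^ 2 := sum_sq_le_sq_sum fun i _ => norm_nonneg _
  have h0 : 0 ≤ ∑ i ∈ range m, (Real.exp ‖η i‖ - 1) :=
    sum_nonneg fun i _ => by linarith [Real.add_one_le_exp ‖η i‖, norm_nonneg (η i)]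
  have hs : 0 ≤ ∑ i ∈ range m, ‖η i‖ := sum_nonneg fun i _ => norm_nonneg _
  nlinarith [mul_le_mul h1 h1 h0 (by linarith)]

end Exp

/-! ## §2c The covector form and its contragredience under lattice gauge transformations -/

section Covector

variable {𝔸 : Type*} [NormedRing 𝔸] [NormedAlgebra ℝ 𝔸]
variable {F : Type*} [NormedAddCommGroup F] [NormedSpace ℝ F]

/-- **THE COVECTOR** at position `i` of the unperturbed product read through `φ`:
`X ↦ φ((u₀⋯u_{i−1}) · X · (u_i u_{i+1}⋯u_{m−1}))` — a continuous linear map built from `u` ONLY (cell reading: `φ = Re tr/N`, the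
covector `H_ℓ(y)` of the skeleton's L5, a function of the UNIT FIELD `y` alone). [folklore] -/
def covector (φ : 𝔸 →L[ℝ] F) (u : ℕ → 𝔸) (m i : ℕ) : 𝔸 →L[ℝ] F :=
  φ.comp (ContinuousLinearMap.mulLeftRight ℝ 𝔸 (pprod u i) (u i * sprod u (i + 1) (m - 1 - i)))

/-- The covector's formula. [folklore] -/
@[simp] theorem covector_apply (φ : 𝔸 →L[ℝ] F) (u : ℕ → 𝔸) (m i : ℕ) (X : 𝔸) :
    covector φ u m i X = φ (pprod u i * X * (u i * sprod u (i + 1) (m - 1 - i))) := by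
  simp [covector]

/-- **THE COVECTOR IS BOUNDED BY `‖φ‖`** for factors of norm `≤ 1` (cell reading: `‖H_ℓ‖ ≤ 1`). [folklore] -/
theorem norm_covector_le [NormOneClass 𝔸] (φ : 𝔸 →L[ℝ] F) {u : ℕ → 𝔸} {m i : ℕ} (hi : i < m) (hu : ∀ k < m, ‖u k‖ ≤ 1) :
    ‖covector φ u m i‖ ≤ ‖φ‖ := by
  refine ContinuousLinearMap.opNorm_le_bound _ (norm_nonneg _) fun X => ?_
  rw [covector_apply]
  refine (φ.le_opNorm _).trans (mul_le_mul_of_nonneg_left ?_ (norm_nonneg _))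
  have h1 : ‖pprod u i * X‖ ≤ 1 * ‖X‖ := norm_mul_le_of_le (norm_pprod_le_one fun k hk => hu k (by omega)) le_rfl
  have h2 : ‖u i * sprod u (i + 1) (m - 1 - i)‖ ≤ 1 * 1 :=
    norm_mul_le_of_le (hu i hi) (norm_sprod_le_one fun k _ hk => hu k (by omega))
  have h := norm_mul_le_of_le h1 h2
  rwa [one_mul, mul_one, mul_one] at h

/-- **THE FIRST-ORDER TERM IS THE SUM OF THE PAIRINGS** `⟨covector_i, η_i⟩`: `Σ_i covector φ u m i (η_i) = φ (firstOrder u (η·u) m)`.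
[folklore] -/
theorem sum_covector_apply_eq (φ : 𝔸 →L[ℝ] F) (u η : ℕ → 𝔸) (m : ℕ) :
    ∑ i ∈ range m, covector φ u m i (η i) = φ (firstOrder u (fun i => η i * u i) m) := by
  rw [firstOrder, map_sum]
  refine sum_congr rfl fun i _ => ?_
  rw [covector_apply]
  congr 1
  noncomm_ring

/-- **THE STRUCTURE LEMMA THROUGH `φ`** (exponential form, unitary case): `‖φ(∏ e^{η_i}u_i) − φ(∏ u_i) − Σ_i ⟨covector_i, η_i⟩‖ ≤
‖φ‖ · ((Σ(e^{‖η_i‖} − 1))²/2 + Σ(e^{‖η_i‖} − 1 − ‖η_i‖))` — the loop-variable difference is the sum of the covector–vector pairings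
up to a second-order scalar. [folklore] -/
theorem norm_sub_sub_sum_covector_le [NormOneClass 𝔸] [CompleteSpace 𝔸] (φ : 𝔸 →L[ℝ] F) {u η : ℕ → 𝔸} {m : ℕ}
    (hu : ∀ i < m, ‖u i‖ ≤ 1) (hu' : ∀ i < m, ‖exp (η i) * u i‖ ≤ 1) :
    ‖φ (pprod (fun i => exp (η i) * u i) m) - φ (pprod u m) - ∑ i ∈ range m, covector φ u m i (η i)‖
      ≤ ‖φ‖ * ((∑ i ∈ range m, (Real.exp ‖η i‖ - 1)) ^ 2 / 2 + ∑ i ∈ range m, (Real.exp ‖η i‖ - 1 - ‖η i‖)) := by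
  rw [sum_covector_apply_eq, ← map_sub, ← map_sub]
  exact (φ.le_opNorm _).trans (mul_le_mul_of_nonneg_left (norm_rem_exp_le hu hu') (norm_nonneg _))

/-- **CONTRAGREDIENCE OF THE COVECTORS**: for a conjugation-invariant `φ` and a CLOSED walk (`h_m = h_0`), transforming the step
variables by `u_i ↦ h_i u_i h_{i+1}⁻¹` and the vector at position `i` by `X ↦ h_i X h_i⁻¹` (`Ad`) leaves the pairing unchanged —
the covector transforms contragrediently to `Ad`; this is the bookkeeping that lets Schur's lemma act on the conditional mean of an
`Ad`-equivariant vector in leaf L6 (S). [folklore] -/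
theorem covector_conjAct_apply (φ : 𝔸 →L[ℝ] F) (hφ : ∀ (g : 𝔸ˣ) (y : 𝔸), φ ((g : 𝔸) * y * ((g⁻¹ : 𝔸ˣ) : 𝔸)) = φ y)
    (h : ℕ → 𝔸ˣ) (u : ℕ → 𝔸) {m i : ℕ} (hi : i < m) (hm : h m = h 0) (X : 𝔸) :
    covector φ (conjAct h u) m i ((h i : 𝔸) * X * ((h i)⁻¹ : 𝔸ˣ)) = covector φ u m i X := by
  rw [covector_apply, covector_apply, pprod_conjAct, sprod_conjAct]
  have hidx : i + 1 + (m - 1 - i) = m := by omega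
  rw [hidx, hm, conjAct]
  have e : (h 0 : 𝔸) * pprod u i * ((h i)⁻¹ : 𝔸ˣ) * ((h i : 𝔸) * X * ((h i)⁻¹ : 𝔸ˣ))
        * ((h i : 𝔸) * u i * ((h (i + 1))⁻¹ : 𝔸ˣ) * ((h (i + 1) : 𝔸) * sprod u (i + 1) (m - 1 - i) * ((h 0)⁻¹ : 𝔸ˣ)))
      = (h 0 : 𝔸) * (pprod u i * X * (u i * sprod u (i + 1) (m - 1 - i))) * ((h 0)⁻¹ : 𝔸ˣ) := by
    simp only [mul_assoc, Units.inv_mul_cancel_left]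
  rw [e, hφ]

end Covector

end Summit.QuantumFields.BalabanUV.T4Continuum.NE1pCouplingStructure
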